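import Literature.Geometry.Manifold.BilinSectionTransport
import Literature.Geometry.Lorentzian.IsometryProofs
import HarnessLib

/-!
# Transporting a deformation of the boundary cylinder back to the ambient manifold
# (Bär–Hanke 2023, §3, proof of Prop. 28)

Topic `Literature/Geometry/Riemannian`. Fourth brick of the proof of
`Literature.Geometry.Riemannian.BarHanke2023_prop28_meanCurvatureIncrease`. Bär–Hanke define
the deformed metric in boundary normal coordinates, `f^δ = g - δψ(t) g_0` for `0 ≤ t ≤ ε` and
`f^δ = g` for `t ≥ ε` — "this defines a family of smooth `(2,0)`-tensor fields on `M`". In the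
tree the normal coordinates are the Fermi chart `ψ : P ⇀ N × ℝ` of a compact hypersurface in an
ambient manifold `P`, inverse to a tube map `T : N × (-ε, ε) → P` along which the cylinder
metric `G` is `T^* g` (`exists_boundaryCylinderMetric`). Given a second metric `Γ` on `N × ℝ`
which agrees with `G` for `|t| ≥ r` (`0 < r < ε`), we build the metric on `P` which is
`ψ^* Γ` on the tube and `g` elsewhere:

* `exists_transport_of_eqOn` — a Riemannian `C^∞` metric `g'` on `P` with `T^* g' = Γ` on the
  slab `|t| < ε`, `g' = g` off the compact set `T(N × [-r, r])`, and `g' = g` at every `T(q)`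
  with `Γ_q = G_q` (so along the hypersurface `t = 0` when `Γ` and `G` agree there).
  Construction: `g' = g + ĥ` with `ĥ = ψ^*(Γ - G)` on `ψ.source` and `0` elsewhere; `ĥ` is a
  `C^∞` section because it vanishes near the complement of the compact `T(N × [-r, r])`
  (`contMDiffAt_pullbackBilin_of_contMDiffAt` on the tube); on the tube `g' = ψ^* Γ` since
  `ψ^* G = ψ^* T^* g = g` there.

No definitions, no named facts (D-0026).

## References

* C. Bär, B. Hanke, *Boundary conditions for scalar curvature*, arXiv:2012.09127, §3, (7) and
  proof of Prop. 28 ("`f^δ = g - sδψ(t)g_0` if `0 ≤ t ≤ ε`, `g` if `t ≥ ε` … a family of smooth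
  `(2,0)`-tensor fields on `M`"). [BarHanke2023]
* B. O'Neill, *Semi-Riemannian geometry* (1983), Ch. 3, Def. 3.9 (pullback of tensors).
  [ONeill1983]
-/

noncomputable section

open Bundle Set Function Filter Metric
open scoped Manifold ContDiff Topology

namespace Literature.Geometry.Riemannian

open Literature.Geometry.Lorentzian Literature.Geometry.Lorentzian.PseudoRiemannianMetric
  Literature.Geometry.Manifold

variable {E' : Type*} [NormedAddCommGroup E'] [NormedSpace ℝ E'] {H' : Type*} [TopologicalSpace H']
  {I' : ModelWithCorners ℝ E' H'} {N : Type*} [TopologicalSpace N] [ChartedSpace H' N]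
  [IsManifold I' ∞ N] [CompactSpace N]
  {EP : Type*} [NormedAddCommGroup EP] [NormedSpace ℝ EP] {HP : Type*} [TopologicalSpace HP]
  {J : ModelWithCorners ℝ EP HP} {P : Type*} [TopologicalSpace P] [ChartedSpace HP P]
  [IsManifold J ∞ P] [T2Space P]

omit [IsManifold I' ∞ N] [CompactSpace N] in
/-- A field of bilinear forms evaluated at equal points (cross-fibre equation in the model
space). [folklore] -/
private theorem sec_congr_point
    (b : Π x : N × ℝ, TangentSpace (I'.prod 𝓘(ℝ, ℝ)) x →L[ℝ] TangentSpace (I'.prod 𝓘(ℝ, ℝ)) x →L[ℝ] ℝ)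
    {x y : N × ℝ} (h : x = y) (v w : E' × ℝ) : b x v w = b y v w := by
  subst h
  rfl

omit [IsManifold J ∞ P] [T2Space P] in
/-- A field of bilinear forms on `P` evaluated at equal points. [folklore] -/
private theorem sec_congr_point'
    (b : Π p : P, TangentSpace J p →L[ℝ] TangentSpace J p →L[ℝ] ℝ)
    {x y : P} (h : x = y) (v w : EP) : b x v w = b y v w := by
  subst h
  rfl

set_option synthInstance.maxHeartbeats 400000 in
set_option maxHeartbeats 3200000 in
/-- **Transport of a deformation of the boundary cylinder to the ambient manifold**
(Bär–Hanke 2023, §3, proof of Prop. 28: the deformed metric is defined in normal coordinates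
near the boundary and equals `g` outside). Let `ψ : P ⇀ N × ℝ` be a Fermi-type chart with
target the slab `N × (-ε, ε)`, inverse `T`, `C^∞` in both directions, `g` a metric on `P` and
`G` a metric on `N × ℝ` with `G = T^* g` on the slab; let `Γ` be a Riemannian metric on `N × ℝ`
which coincides with `G` wherever `|t| ≥ r`, `0 < r < ε`, and let `g` be Riemannian. Then there
is a Riemannian `C^∞` metric `g'` on `P` with `T^* g' = Γ` on the slab, `g' = g` off the compact
set `T(N × [-r, r])`, and `g'_{T q} = g_{T q}` at every `q` in the slab with `Γ_q = G_q`.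
[cite: BarHanke2023, §3, proof of Prop. 28] -/
theorem exists_transport_of_eqOn
    (g : PseudoRiemannianMetric J ∞ EP (TangentSpace J : P → Type _)) (hg : g.IsRiemannian)
    (G Γ : PseudoRiemannianMetric (I'.prod 𝓘(ℝ, ℝ)) ∞ (E' × ℝ)
      (TangentSpace (I'.prod 𝓘(ℝ, ℝ)) : N × ℝ → Type _)) (hΓ : Γ.IsRiemannian)
    {ε r : ℝ} (hr : 0 < r) (hrε : r < ε)
    (T : N × ℝ → P) (ψ : OpenPartialHomeomorph P (N × ℝ))
    (htgt : ψ.target = (univ : Set N) ×ˢ Ioo (-ε) ε)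
    (hsymm : ∀ q, ψ.symm q = T q)
    (hψ : ContMDiffOn J (I'.prod 𝓘(ℝ, ℝ)) ∞ ψ ψ.source)
    (hTs : ∀ q : N × ℝ, q.2 ∈ Ioo (-ε) ε → ContMDiffAt (I'.prod 𝓘(ℝ, ℝ)) J ∞ T q)
    (hGval : ∀ (z : N), ∀ t ∈ Ioo (-ε) ε,
      G.val (z, t) = pullbackBilin (I := J) (I' := I'.prod 𝓘(ℝ, ℝ)) T g.val (z, t))
    (hΓG : ∀ q : N × ℝ, r ≤ |q.2| → Γ.val q = G.val q) :
    ∃ g' : PseudoRiemannianMetric J ∞ EP (TangentSpace J : P → Type _),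
      g'.IsRiemannian ∧
      (∀ (z : N), ∀ t ∈ Ioo (-ε) ε,
        Γ.val (z, t) = pullbackBilin (I := J) (I' := I'.prod 𝓘(ℝ, ℝ)) T g'.val (z, t)) ∧
      IsCompact (T '' ((univ : Set N) ×ˢ Icc (-r) r)) ∧
      (∀ p, p ∉ T '' ((univ : Set N) ×ˢ Icc (-r) r) → g'.val p = g.val p) ∧
      (∀ q : N × ℝ, q.2 ∈ Ioo (-ε) ε → Γ.val q = G.val q → g'.val (T q) = g.val (T q)) := by
  classical
  set I2 := I'.prod 𝓘(ℝ, ℝ) with hI2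
  have hε : 0 < ε := hr.trans hrε
  -- bookkeeping on the chart
  have hslab_tgt : ∀ q : N × ℝ, q.2 ∈ Ioo (-ε) ε → q ∈ ψ.target := fun q hq ↦ by
    rw [htgt]; exact ⟨mem_univ _, hq⟩
  have hTsrc : ∀ q : N × ℝ, q.2 ∈ Ioo (-ε) ε → T q ∈ ψ.source := fun q hq ↦ by
    rw [← hsymm]; exact ψ.map_target (hslab_tgt q hq)
  have hψT : ∀ q : N × ℝ, q.2 ∈ Ioo (-ε) ε → ψ (T q) = q := fun q hq ↦ by
    rw [← hsymm]; exact ψ.right_inv (hslab_tgt q hq)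
  have hTψ : ∀ p ∈ ψ.source, T (ψ p) = p := fun p hp ↦ by
    rw [← hsymm]; exact ψ.left_inv hp
  have hψ2 : ∀ p ∈ ψ.source, (ψ p).2 ∈ Ioo (-ε) ε := fun p hp ↦ by
    have h := ψ.map_source hp
    rw [htgt] at h
    exact h.2
  -- differentials: `dT ∘ dψ = id` on the source, `dψ ∘ dT = id` on the slab
  have hψd : ∀ p ∈ ψ.source, MDifferentiableAt J I2 ψ p := fun p hp ↦
    ((hψ p hp).contMDiffAt (ψ.open_source.mem_nhds hp)).mdifferentiableAt (by simp)
  have hTd : ∀ q : N × ℝ, q.2 ∈ Ioo (-ε) ε → MDifferentiableAt I2 J T q := fun q hq ↦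
    (hTs q hq).mdifferentiableAt (by simp)
  have hslab_open : IsOpen ((univ : Set N) ×ˢ Ioo (-ε) ε) := isOpen_univ.prod isOpen_Ioo
  have hcompTψ : ∀ p ∈ ψ.source, ∀ v : TangentSpace J p,
      mfderiv I2 J T (ψ p) (mfderiv J I2 ψ p v) = v := by
    intro p hp v
    have hid : ∀ᶠ p' in 𝓝 p, (T ∘ ψ) p' = id p' := by
      filter_upwards [ψ.open_source.mem_nhds hp] with p' hp'
      exact hTψ p' hp'
    have hcomp : mfderiv J J (T ∘ ψ) p = (mfderiv I2 J T (ψ p)).comp (mfderiv J I2 ψ p) :=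
      mfderiv_comp p (hTd _ (hψ2 p hp)) (hψd p hp)
    have h := DFunLike.congr_fun hcomp v
    rw [Filter.EventuallyEq.mfderiv_eq hid, mfderiv_id] at h
    exact h.symm
  have hcompψT : ∀ q : N × ℝ, q.2 ∈ Ioo (-ε) ε → ∀ v : TangentSpace I2 q,
      mfderiv J I2 ψ (T q) (mfderiv I2 J T q v) = v := by
    intro q hq v
    have hid : ∀ᶠ q' in 𝓝 q, (ψ ∘ T) q' = id q' := by
      filter_upwards [hslab_open.mem_nhds (show q ∈ (univ : Set N) ×ˢ Ioo (-ε) ε from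
        ⟨mem_univ _, hq⟩)] with q' hq'
      exact hψT q' hq'.2
    have hcomp : mfderiv I2 I2 (ψ ∘ T) q = (mfderiv J I2 ψ (T q)).comp (mfderiv I2 J T q) :=
      mfderiv_comp q (hψd _ (hTsrc q hq)) (hTd q hq)
    have h := DFunLike.congr_fun hcomp v
    rw [Filter.EventuallyEq.mfderiv_eq hid, mfderiv_id] at h
    exact h.symm
  -- the difference section `b = Γ - G` on `N × ℝ` and its transport `ĥ`
  set b : Π q : N × ℝ, TangentSpace I2 q →L[ℝ] TangentSpace I2 q →L[ℝ] ℝ :=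
    fun q ↦ Γ.val q - G.val q with hb
  have hb_apply : ∀ q v w, b q v w = Γ.val q v w - G.val q v w := fun q v w ↦ rfl
  have hbs : ∀ q, ContMDiffAt I2 (I2.prod 𝓘(ℝ, (E' × ℝ) →L[ℝ] (E' × ℝ) →L[ℝ] ℝ)) ∞
      (fun q : N × ℝ ↦ TotalSpace.mk' ((E' × ℝ) →L[ℝ] (E' × ℝ) →L[ℝ] ℝ)
        (E := fun q : N × ℝ ↦ TangentSpace I2 q →L[ℝ] TangentSpace I2 q →L[ℝ] ℝ) q (b q)) q :=
    fun q ↦ (Γ.contMDiff q).sub_section (G.contMDiff q)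
  have hb0 : ∀ q : N × ℝ, r ≤ |q.2| → b q = 0 := fun q hq ↦ by
    rw [hb]
    show Γ.val q - G.val q = 0
    rw [hΓG q hq]
    exact sub_self (G.val q)
  set ĥ : Π p : P, TangentSpace J p →L[ℝ] TangentSpace J p →L[ℝ] ℝ :=
    fun p ↦ if p ∈ ψ.source then pullbackBilin (I := I2) (I' := J) ψ b p else 0 with hĥ
  -- the compact set `K₁ = T(N × [-r, r])`
  set K₁ : Set P := T '' ((univ : Set N) ×ˢ Icc (-r) r) with hK₁
  have hIcc_sub : ∀ t ∈ Icc (-r) r, t ∈ Ioo (-ε) ε := fun t ht ↦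
    ⟨by linarith [ht.1], by linarith [ht.2]⟩
  have hK₁cpt : IsCompact K₁ := by
    refine (isCompact_univ.prod isCompact_Icc).image_of_continuousOn fun q hq ↦ ?_
    exact (hTs q (hIcc_sub q.2 hq.2)).continuousAt.continuousWithinAt
  have hK₁closed : IsClosed K₁ := hK₁cpt.isClosed
  have hK₁src : K₁ ⊆ ψ.source := by
    rintro _ ⟨q, hq, rfl⟩
    exact hTsrc q (hIcc_sub q.2 hq.2)
  -- `ĥ = 0` off `K₁`
  have hĥ0 : ∀ p, p ∉ K₁ → ĥ p = 0 := by
    intro p hp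
    by_cases hps : p ∈ ψ.source
    · rw [hĥ]
      simp only [hps, if_true]
      have hq2 : r < |(ψ p).2| := by
        by_contra h
        rw [not_lt] at h
        apply hp
        refine ⟨ψ p, ⟨mem_univ _, abs_le.1 h⟩, hTψ p hps⟩
      have hbq : b (ψ p) = 0 := hb0 (ψ p) hq2.le
      refine ContinuousLinearMap.ext fun v ↦ ContinuousLinearMap.ext fun w ↦ ?_
      rw [pullbackBilin_apply, hbq]
      rfl
    · rw [hĥ]
      simp only [hps, if_false]
  -- smoothness of `ĥ`
  have hĥs : ContMDiff J (J.prod 𝓘(ℝ, EP →L[ℝ] EP →L[ℝ] ℝ)) ∞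
      (fun p : P ↦ TotalSpace.mk' (EP →L[ℝ] EP →L[ℝ] ℝ)
        (E := fun p : P ↦ TangentSpace J p →L[ℝ] TangentSpace J p →L[ℝ] ℝ) p (ĥ p)) := by
    intro p
    by_cases hps : p ∈ ψ.source
    · have hψp : ContMDiffAt J I2 (∞ + 1) ψ p := by
        have h : ((∞ : ℕ∞ω) + 1) = ∞ := rfl
        rw [h]
        exact (hψ p hps).contMDiffAt (ψ.open_source.mem_nhds hps)
      have h1 := contMDiffAt_pullbackBilin_of_contMDiffAt (I := I2) (I' := J) hψp (hbs (ψ p))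
      refine h1.congr_of_eventuallyEq ?_
      filter_upwards [ψ.open_source.mem_nhds hps] with p' hp'
      rw [hĥ]
      simp only [hp', if_true]
    · have hev : ∀ᶠ p' in 𝓝 p, ĥ p' = 0 := by
        filter_upwards [hK₁closed.isOpen_compl.mem_nhds (fun h ↦ hps (hK₁src h))] with p' hp'
        exact hĥ0 p' hp'
      refine (Bundle.contMDiff_zeroSection ℝ
        (fun p : P ↦ TangentSpace J p →L[ℝ] TangentSpace J p →L[ℝ] ℝ) p).congr_of_eventuallyEq ?_
      filter_upwards [hev] with p' hp'
      rw [hp']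
      rfl
  -- on the source: `g = ψ^* G` and hence `g + ĥ = ψ^* Γ`
  have hgψ : ∀ p ∈ ψ.source, ∀ v w : TangentSpace J p,
      g.val p v w = G.val (ψ p) (mfderiv J I2 ψ p v) (mfderiv J I2 ψ p w) := by
    intro p hp v w
    have hq2 : (ψ p).2 ∈ Ioo (-ε) ε := hψ2 p hp
    have hG := hGval (ψ p).1 (ψ p).2 hq2
    rw [show ((ψ p).1, (ψ p).2) = ψ p from rfl] at hG
    rw [hG, pullbackBilin_apply, hcompTψ p hp v, hcompTψ p hp w]
    exact (sec_congr_point' g.val (hTψ p hp) v w).symm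
  set val : Π p : P, TangentSpace J p →L[ℝ] TangentSpace J p →L[ℝ] ℝ := fun p ↦ g.val p + ĥ p
    with hval
  have hval_apply : ∀ p v w, val p v w = g.val p v w + ĥ p v w := fun p v w ↦ rfl
  have hval_src : ∀ p ∈ ψ.source, ∀ v w : TangentSpace J p,
      val p v w = Γ.val (ψ p) (mfderiv J I2 ψ p v) (mfderiv J I2 ψ p w) := by
    intro p hp v w
    rw [hval_apply, hgψ p hp v w, hĥ]
    simp only [hp, if_true]
    rw [pullbackBilin_apply, hb_apply]
    ring
  have hval_off : ∀ p, p ∉ K₁ → val p = g.val p := fun p hp ↦ by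
    rw [hval]
    show g.val p + ĥ p = g.val p
    rw [hĥ0 p hp]
    exact add_zero (g.val p)
  -- positivity
  have hvpos : ∀ (p : P) (v : TangentSpace J p), v ≠ 0 → 0 < val p v v := by
    intro p v hv
    by_cases hps : p ∈ ψ.source
    · rw [hval_src p hps v v]
      refine hΓ (ψ p) _ fun h0 ↦ hv ?_
      have h := hcompTψ p hps v
      rw [h0, map_zero] at h
      exact h.symm
    · have hpK : p ∉ K₁ := fun h ↦ hps (hK₁src h)
      rw [show val p v v = g.val p v v from by rw [hval_off p hpK]]
      exact hg p v hv
  -- smoothness of `val`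
  have hsmooth : ContMDiff J (J.prod 𝓘(ℝ, EP →L[ℝ] EP →L[ℝ] ℝ)) ∞
      (fun p : P ↦ TotalSpace.mk' (EP →L[ℝ] EP →L[ℝ] ℝ)
        (E := fun p : P ↦ TangentSpace J p →L[ℝ] TangentSpace J p →L[ℝ] ℝ) p (val p)) :=
    fun p ↦ (g.contMDiff p).add_section (hĥs p)
  refine ⟨⟨val, ?_, ?_, hsmooth⟩, fun p v hv ↦ hvpos p v hv, ?_, hK₁cpt, hval_off, ?_⟩
  · -- symmetry
    intro p v w
    by_cases hps : p ∈ ψ.source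
    · rw [hval_src p hps v w, hval_src p hps w v, Γ.symm]
    · have hpK : p ∉ K₁ := fun h ↦ hps (hK₁src h)
      rw [show val p v w = g.val p v w from by rw [hval_off p hpK],
        show val p w v = g.val p w v from by rw [hval_off p hpK], g.symm]
  · -- nondegeneracy
    intro p v hv
    by_contra hne
    exact (hvpos p v hne).ne' (hv v)
  · -- `T^* g' = Γ` on the slab
    intro z t ht
    have hq : ((z, t) : N × ℝ).2 ∈ Ioo (-ε) ε := ht
    refine ContinuousLinearMap.ext fun v ↦ ContinuousLinearMap.ext fun w ↦ ?_
    rw [pullbackBilin_apply]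
    show Γ.val (z, t) v w = val (T (z, t)) _ _
    rw [hval_src (T (z, t)) (hTsrc _ hq), hcompψT (z, t) hq v, hcompψT (z, t) hq w]
    exact sec_congr_point Γ.val (hψT (z, t) hq).symm v w
  · -- `g' = g` at `T q` when `Γ_q = G_q`
    intro q hq hΓq
    have hsrc := hTsrc q hq
    refine ContinuousLinearMap.ext fun v ↦ ContinuousLinearMap.ext fun w ↦ ?_
    show val (T q) v w = g.val (T q) v w
    rw [hval_apply, hĥ]
    simp only [hsrc, if_true]
    rw [pullbackBilin_apply, hb_apply]
    have h1 := sec_congr_point Γ.val (hψT q hq) (mfderiv J I2 ψ (T q) v) (mfderiv J I2 ψ (T q) w)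
    have h2 := sec_congr_point G.val (hψT q hq) (mfderiv J I2 ψ (T q) v) (mfderiv J I2 ψ (T q) w)
    rw [h1, h2, hΓq, sub_self, add_zero]

end Literature.Geometry.Riemannian
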